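import Summits.AtomisticToContinuum.BoseEinsteinCondensation.Theses.BECConjugateDomination
import Literature.MathematicalPhysics.QuantumManyBody.WeightedCorrector
import Literature.MathematicalPhysics.QuantumManyBody.GroundStateDirichletForm
import Literature.MathematicalPhysics.QuantumManyBody.PeriodicBoseGasMomentumSector

/-!
# Sketch (crux-ideate, round 1, ideator 2) — crux `BECConjugateDomination.InfraredMinimumUncertainty`

First lemmas of the two crux idea cards of seat `planner-cruxidea-stmt-AtomisticToContinuum-11784-2-0`:

* card `levy-spectrum-insertion-corrector`: `IsMassiveWeakCorrector`, the PROVED recoil floor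
  `massiveCorrectorRecoilBound` (`4κ‖δ‖² ≤ ‖g‖²₋₁` for a weak solution of `(-L_F + κ)δ = g`), and the
  typed line statements `CorrectorExistence`, `LevyCorrectorDomination`, `CorrectorPhononFloor`;
* card `free-susceptibility-domination`: the typed energy inequality `CoherenceCostsEnergy` and the
  PROVED variational Falk–Bruch inequality `variationalFalkBruch` (`m₀² ≤ m₁ · m₋₁` over the
  ground-state form, no spectral calculus).

Everything is stated over existing declarations (route file + `WeightedCorrector`,
`GroundStateDirichletForm`, `PeriodicBoseGasFourier`, `PeriodicBoseGasMomentumSector`).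
-/

noncomputable section

namespace Summit.AtomisticToContinuum.BoseEinsteinCondensation.Cruxes.InfraredMinimumUncertainty.Sketch2

open MeasureTheory Filter
open scoped ENNReal
open Literature.MathematicalPhysics.QuantumManyBody.BoseGas

/-! ## Card 1 — Lévy spectrum = power spectrum of the log-insertion amplitude -/

/-- `δ` solves the MASSIVE weighted Poisson (corrector) equation `(-L_F + κ) δ = g` weakly on the
`C¹` periodic core: `𝓔_F(δ, φ) + κ ∫ δ φ F² = ∫ g φ F²` for every periodic test `φ`
(`κ = |k|²` is the recoil of the inserted particle in the `k`-th Fourier mode of its coordinate). -/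
def IsMassiveWeakCorrector {N : ℕ} (L : ℝ) (F : Config N → ℝ) (κ : ℝ) (g δ : Config N → ℝ) : Prop :=
  IsPeriodicTest L δ ∧
    ∀ φ : Config N → ℝ, IsPeriodicTest L φ →
      dirichletFormW L F δ φ + κ * ∫ X in cellN N L, δ X * φ X * F X ^ 2 =
        ∫ X in cellN N L, g X * φ X * F X ^ 2

/-- **Recoil floor (first lemma of card 1, PROVED).** For a weak solution `δ` of `(-L_F + κ)δ = g`,
`4 κ ∫ δ² F² ≤ ‖g‖²₋₁` (for every real `κ`; content for `κ > 0`): the variational form of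
`(ω + κ)⁻² ≤ (4ωκ)⁻¹`, i.e. one inverse power of energy is paid by the recoil `κ`. Proof: test the `H₋₁` supremum against `s δ` and use
`(a + κb)² ≥ 4aκb` with `a = 𝓔_F(δ,δ)`, `b = ∫ δ²F²`. -/
theorem massiveCorrectorRecoilBound {N : ℕ} (L : ℝ) (F : Config N → ℝ) {κ : ℝ}
    (g δ : Config N → ℝ) (h : IsMassiveWeakCorrector L F κ g δ) :
    ENNReal.ofReal (4 * κ * ∫ X in cellN N L, δ X ^ 2 * F X ^ 2) ≤ hMinusOneSqW L F g := by
  obtain ⟨hδ, hweak⟩ := h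
  have ha : 0 ≤ dirichletFormW L F δ δ := dirichletFormW_self_nonneg L F δ
  have hb : 0 ≤ ∫ X in cellN N L, δ X ^ 2 * F X ^ 2 :=
    integral_nonneg fun X => mul_nonneg (sq_nonneg _) (sq_nonneg _)
  have hid : dirichletFormW L F δ δ + κ * ∫ X in cellN N L, δ X ^ 2 * F X ^ 2 =
      ∫ X in cellN N L, g X * δ X * F X ^ 2 := by
    have h2 : ∫ X in cellN N L, δ X * δ X * F X ^ 2 = ∫ X in cellN N L, δ X ^ 2 * F X ^ 2 := by
      congr 1 with X; ring
    rw [← h2]; exact hweak δ hδ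
  have key : ∀ s : ℝ, ENNReal.ofReal (2 * (s * ∫ X in cellN N L, g X * δ X * F X ^ 2) -
      s * (s * dirichletFormW L F δ δ)) ≤ hMinusOneSqW L F g := by
    intro s
    have := le_hMinusOneSqW L F g (hδ.smul s)
    rwa [integral_mul_smul_mul_sq, dirichletFormW_smul_left, dirichletFormW_smul_right] at this
  generalize dirichletFormW L F δ δ = a at ha hid key
  generalize (∫ X in cellN N L, δ X ^ 2 * F X ^ 2) = b at hb hid key ⊢
  generalize (∫ X in cellN N L, g X * δ X * F X ^ 2) = p at hid key
  by_cases ha0 : a = 0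
  · subst ha0
    have h := key 2
    have hp : p = κ * b := by linarith
    calc ENNReal.ofReal (4 * κ * b) = ENNReal.ofReal (2 * (2 * p) - 2 * (2 * 0)) := by
          congr 1; rw [hp]; ring
      _ ≤ hMinusOneSqW L F g := h
  · have hapos : 0 < a := lt_of_le_of_ne ha (Ne.symm ha0)
    have h := key (p / a)
    have hval : 2 * (p / a * p) - p / a * (p / a * a) = p ^ 2 / a := by
      field_simp
      ring
    rw [hval] at h
    refine le_trans (ENNReal.ofReal_le_ofReal ?_) h
    rw [le_div_iff₀ hapos, ← hid]
    nlinarith [sq_nonneg (a - κ * b), hb, ha]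

/-- The Fourier transform `ṽ(k) = ∫_{ℝ³} v(|x|) cos(k·x) dx` of the (finite, radial) pair potential. -/
def vhat (v : ℝ → ℝ≥0∞) (k : Space) : ℝ :=
  ∫ x : Space, (v ‖x‖).toReal * Real.cos (∑ i : Fin 3, k i * x i)

/-- **Corrector existence (support).** For the positive minimiser `Θ` of the `n`-body periodic energy
on the torus of side `L = sideLength ρ (n+1)` and every mode `m ≠ 0`, the two real massive corrector
equations `(-L_Θ + |k|²) δ = W` with sources `W_re(Y) = L⁻³ ṽ(k) ∑ⱼ cos(k·yⱼ)`,
`W_im(Y) = -L⁻³ ṽ(k) ∑ⱼ sin(k·yⱼ)` (the `k`-th x-Fourier mode of the insertion potential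
`∑ⱼ v(x − yⱼ)`, `k = 2πm/L`) have weak `C¹` periodic solutions (elliptic regularity on a compact
torus with `C²` data). -/
def CorrectorExistence : Prop :=
  ∀ v : ℝ → ℝ≥0∞, IsRepulsiveFiniteRange v → (∀ r, v r ≠ ⊤) →
    ContDiff ℝ 2 (fun x : Space => (v ‖x‖).toReal) →
    ∀ ρ : ℝ, 0 < ρ → ∀ n : ℕ, ∀ Θ : PeriodicTrialState n (sideLength ρ (n + 1)),
      (let L : ℝ := sideLength ρ (n + 1)
       periodicEnergy v Θ = periodicGroundStateEnergy v n L → periodicEnergy v Θ ≠ ⊤ →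
       (∀ Y, Θ.ψ Y = (‖Θ.ψ Y‖ : ℂ)) → (∀ Y, Θ.ψ Y ≠ 0) →
       ∀ m : Fin 3 → ℤ, m ≠ 0 →
        (let kv : Space := (2 * Real.pi / L) • latticeVec 1 m
         let FΘ : Config n → ℝ := fun Y => ‖Θ.ψ Y‖
         let Wre : Config n → ℝ := fun Y =>
           (L ^ 3)⁻¹ * vhat v kv * ∑ j : Fin n, Real.cos (∑ i : Fin 3, kv i * Y j i)
         let Wim : Config n → ℝ := fun Y =>
           -((L ^ 3)⁻¹ * vhat v kv * ∑ j : Fin n, Real.sin (∑ i : Fin 3, kv i * Y j i))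
         ∃ δre δim : Config n → ℝ,
           IsMassiveWeakCorrector L FΘ (‖kv‖ ^ 2) Wre δre ∧
           IsMassiveWeakCorrector L FΘ (‖kv‖ ^ 2) Wim δim))

/-- **Lévy–corrector domination (crux stub, the transplanted Kipnis–Varadhan truncation as an
inequality).** For the positive minimisers `Ψ` (`n+1` bodies) and `Θ` (`n` bodies) on the same torus,
the Lévy weight `ν_m` of `log g` of `Ψ` (exactly the crux's `ν`) is dominated by the bath power of the
first massive corrector: `(n+1)·ν_m ≤ C·(n+1)·∫ (δre² + δim²) |Θ|²`. Bogoliubov: equality with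
`C = 1` at every `k` (`v_k² = g² S_k/(E_k + k²)²`). -/
def LevyCorrectorDomination : Prop :=
  ∀ v : ℝ → ℝ≥0∞, IsRepulsiveFiniteRange v → (∀ r, v r ≠ ⊤) →
    ContDiff ℝ 2 (fun x : Space => (v ‖x‖).toReal) →
    (∃ Cₑ : ℝ, ∀ x : Space, ‖iteratedFDeriv ℝ 2 (fun x : Space => (v ‖x‖).toReal) x‖ ≤
      Cₑ * Real.sqrt ((v ‖x‖).toReal)) →
    ∃ C : ℝ, 0 ≤ C ∧ ∃ ρ₀ : ℝ, 0 < ρ₀ ∧ ∀ ρ : ℝ, 0 < ρ → ρ < ρ₀ → ∀ᶠ n : ℕ in atTop,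
      ∀ Ψ : PeriodicTrialState (n + 1) (sideLength ρ (n + 1)),
      ∀ Θ : PeriodicTrialState n (sideLength ρ (n + 1)),
      (let L : ℝ := sideLength ρ (n + 1)
       let g : Space → ℝ := fun r => ∫ x in cell L, ∫ Y in cellN n L,
         ‖Ψ.ψ (Matrix.vecCons (x + r) Y)‖ * ‖Ψ.ψ (Matrix.vecCons x Y)‖
       let ν : (Fin 3 → ℤ) → ℝ := fun m =>
         (cellFourierCoeff L (fun r : Space => ((Real.log (g r) : ℝ) : ℂ)) m).re
       periodicEnergy v Ψ = periodicGroundStateEnergy v (n + 1) L → periodicEnergy v Ψ ≠ ⊤ →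
       (∀ X, Ψ.ψ X = (‖Ψ.ψ X‖ : ℂ)) → (∀ X, Ψ.ψ X ≠ 0) →
       periodicEnergy v Θ = periodicGroundStateEnergy v n L → periodicEnergy v Θ ≠ ⊤ →
       (∀ Y, Θ.ψ Y = (‖Θ.ψ Y‖ : ℂ)) → (∀ Y, Θ.ψ Y ≠ 0) →
       ∀ m : Fin 3 → ℤ, m ≠ 0 →
        (let kv : Space := (2 * Real.pi / L) • latticeVec 1 m
         let FΘ : Config n → ℝ := fun Y => ‖Θ.ψ Y‖
         let Wre : Config n → ℝ := fun Y =>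
           (L ^ 3)⁻¹ * vhat v kv * ∑ j : Fin n, Real.cos (∑ i : Fin 3, kv i * Y j i)
         let Wim : Config n → ℝ := fun Y =>
           -((L ^ 3)⁻¹ * vhat v kv * ∑ j : Fin n, Real.sin (∑ i : Fin 3, kv i * Y j i))
         ∀ δre δim : Config n → ℝ,
           IsMassiveWeakCorrector L FΘ (‖kv‖ ^ 2) Wre δre →
           IsMassiveWeakCorrector L FΘ (‖kv‖ ^ 2) Wim δim →
           ((n : ℝ) + 1) * ν m ≤
             C * (((n : ℝ) + 1) * ∫ Y in cellN n L, (δre Y ^ 2 + δim Y ^ 2) * ‖Θ.ψ Y‖ ^ 2)))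

/-- **Corrector phonon floor (crux stub, where the infrared difficulty is parked).** The bath power
of the first massive corrector times the structure factor of `Ψ` is bounded:
`(n+1)·∫(δre²+δim²)|Θ|² · S_m ≤ C'`. For `|k| ≥ √(ρ ṽ(0))` it follows from
`massiveCorrectorRecoilBound` + the static density response bound (route BECInsertionCorrector,
item stmt-AtomisticToContinuum-12057) + `S ≤ 1 + o(1)`; below the healing momentum it is a
phonon floor in `m₋₂`-averaged form. Bogoliubov: `C' = 1/4`. -/
def CorrectorPhononFloor : Prop :=
  ∀ v : ℝ → ℝ≥0∞, IsRepulsiveFiniteRange v → (∀ r, v r ≠ ⊤) →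
    ContDiff ℝ 2 (fun x : Space => (v ‖x‖).toReal) →
    (∃ Cₑ : ℝ, ∀ x : Space, ‖iteratedFDeriv ℝ 2 (fun x : Space => (v ‖x‖).toReal) x‖ ≤
      Cₑ * Real.sqrt ((v ‖x‖).toReal)) →
    ∃ C : ℝ, 0 ≤ C ∧ ∃ ρ₀ : ℝ, 0 < ρ₀ ∧ ∀ ρ : ℝ, 0 < ρ → ρ < ρ₀ → ∀ᶠ n : ℕ in atTop,
      ∀ Ψ : PeriodicTrialState (n + 1) (sideLength ρ (n + 1)),
      ∀ Θ : PeriodicTrialState n (sideLength ρ (n + 1)),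
      (let L : ℝ := sideLength ρ (n + 1)
       let S : (Fin 3 → ℤ) → ℝ := fun m => ((n : ℝ) + 1)⁻¹ *
         ∫ X in cellN (n + 1) L, ‖∑ j : Fin (n + 1), cellWave L m (X j)‖ ^ 2 * ‖Ψ.ψ X‖ ^ 2
       periodicEnergy v Ψ = periodicGroundStateEnergy v (n + 1) L → periodicEnergy v Ψ ≠ ⊤ →
       (∀ X, Ψ.ψ X = (‖Ψ.ψ X‖ : ℂ)) → (∀ X, Ψ.ψ X ≠ 0) →
       periodicEnergy v Θ = periodicGroundStateEnergy v n L → periodicEnergy v Θ ≠ ⊤ →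
       (∀ Y, Θ.ψ Y = (‖Θ.ψ Y‖ : ℂ)) → (∀ Y, Θ.ψ Y ≠ 0) →
       ∀ m : Fin 3 → ℤ, m ≠ 0 →
        (let kv : Space := (2 * Real.pi / L) • latticeVec 1 m
         let FΘ : Config n → ℝ := fun Y => ‖Θ.ψ Y‖
         let Wre : Config n → ℝ := fun Y =>
           (L ^ 3)⁻¹ * vhat v kv * ∑ j : Fin n, Real.cos (∑ i : Fin 3, kv i * Y j i)
         let Wim : Config n → ℝ := fun Y =>
           -((L ^ 3)⁻¹ * vhat v kv * ∑ j : Fin n, Real.sin (∑ i : Fin 3, kv i * Y j i))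
         ∀ δre δim : Config n → ℝ,
           IsMassiveWeakCorrector L FΘ (‖kv‖ ^ 2) Wre δre →
           IsMassiveWeakCorrector L FΘ (‖kv‖ ^ 2) Wim δim →
           (((n : ℝ) + 1) * ∫ Y in cellN n L, (δre Y ^ 2 + δim Y ^ 2) * ‖Θ.ψ Y‖ ^ 2) * S m ≤ C))

/-! ## Card 2 — free-susceptibility domination (continuum Gaussian domination without RP) -/

/-- **Coherence costs energy at the free rate (crux stub C⁺, typed as an energy inequality).**
For every periodic trial state `Φ` of `n+1` bosons within `δ` of the ground-state energy and every
mode `m ≠ 0`, the `0 ↔ k` coherence of its one-body density matrix, per particle,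
`coh = Re L³ ∫ conj(ĉ₀Φ(·,Y)) ĉ_mΦ(·,Y) dY = Re γ_Φ(0,k)/N`, satisfies `coh² ≤ C δ/(N |k|²)`
(free Bose gas: `C = 1`; Bogoliubov: `C = 1`). Second order in `δ` = the static susceptibility bound
`χ_{B_kB_k} ≤ 4C/|k|²` for `B_k = (a₀†a_k + h.c.)/√N`, i.e. a `k`-resolved phase-stiffness floor. -/
def CoherenceCostsEnergy : Prop :=
  ∀ v : ℝ → ℝ≥0∞, IsRepulsiveFiniteRange v → (∀ r, v r ≠ ⊤) →
    ContDiff ℝ 2 (fun x : Space => (v ‖x‖).toReal) →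
    (∃ Cₑ : ℝ, ∀ x : Space, ‖iteratedFDeriv ℝ 2 (fun x : Space => (v ‖x‖).toReal) x‖ ≤
      Cₑ * Real.sqrt ((v ‖x‖).toReal)) →
    ∃ C : ℝ, 0 ≤ C ∧ ∃ ρ₀ : ℝ, 0 < ρ₀ ∧ ∀ ρ : ℝ, 0 < ρ → ρ < ρ₀ → ∀ᶠ n : ℕ in atTop,
      ∀ Φ : PeriodicTrialState (n + 1) (sideLength ρ (n + 1)), ∀ δ : ℝ≥0∞,
      (let L : ℝ := sideLength ρ (n + 1)
       periodicEnergy v Φ ≤ periodicGroundStateEnergy v (n + 1) L + δ → δ ≠ ⊤ →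
       ∀ m : Fin 3 → ℤ, m ≠ 0 →
        (let kv : Space := (2 * Real.pi / L) • latticeVec 1 m
         let coh : ℝ := (((L ^ 3 : ℝ) : ℂ) * ∫ Y in cellN n L,
           starRingEnd ℂ (cellFourierCoeff L (fun x : Space => Φ.ψ (Matrix.vecCons x Y)) 0) *
             cellFourierCoeff L (fun x : Space => Φ.ψ (Matrix.vecCons x Y)) m).re
         coh ^ 2 ≤ C * δ.toReal / (((n : ℝ) + 1) * ‖kv‖ ^ 2)))

/-- **Variational Falk–Bruch at `T = 0` (first lemma of card 2, PROVED): `m₀² ≤ m₁ · m₋₁`.**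
For a weight `w` (= `|Ψ|`, the positive minimiser) and a real periodic test observable `G`
(= `B_kΨ/Ψ` for the real `0 ↔ k` transfer operator `B_k`), `(∫ G² w²)² ≤ 𝓔_w(G,G) · ‖G‖²₋₁`:
the Cauchy–Schwarz moment inequality `(∫dμ)² ≤ ∫ω dμ · ∫ω⁻¹ dμ` for the spectral measure of `GΨ`
(`m₀ = ‖GΨ‖²`, `m₁ = ⟨GΨ,(H−E₀)GΨ⟩ = ½⟨[G,[H,G]]⟩`, `m₋₁ = χ_{GG}`), proved WITHOUT spectral
calculus by testing the `H₋₁` supremum against `sG`, `s = m₀/m₁`. With the susceptibility bound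
`χ ≤ C/|k|²` (second order of `CoherenceCostsEnergy`) it yields the `1/|k|` law for occupations. -/
theorem variationalFalkBruch {N : ℕ} (L : ℝ) (w G : Config N → ℝ) (hG : IsPeriodicTest L G)
    (hE : 0 < dirichletFormW L w G G) :
    ENNReal.ofReal (∫ X in cellN N L, G X ^ 2 * w X ^ 2) ^ 2 ≤
      ENNReal.ofReal (dirichletFormW L w G G) * hMinusOneSqW L w G := by
  have hm : ∫ X in cellN N L, G X * G X * w X ^ 2 = ∫ X in cellN N L, G X ^ 2 * w X ^ 2 := by
    congr 1 with X; ring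
  have hm0 : 0 ≤ ∫ X in cellN N L, G X ^ 2 * w X ^ 2 :=
    integral_nonneg fun X => mul_nonneg (sq_nonneg _) (sq_nonneg _)
  have key : ∀ s : ℝ, ENNReal.ofReal (2 * (s * ∫ X in cellN N L, G X ^ 2 * w X ^ 2) -
      s * (s * dirichletFormW L w G G)) ≤ hMinusOneSqW L w G := by
    intro s
    have := le_hMinusOneSqW L w G (hG.smul s)
    rwa [integral_mul_smul_mul_sq, dirichletFormW_smul_left, dirichletFormW_smul_right, hm] at this
  clear hm
  generalize (∫ X in cellN N L, G X ^ 2 * w X ^ 2) = m at hm0 key ⊢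
  generalize dirichletFormW L w G G = E at hE key ⊢
  have hE0 : E ≠ 0 := hE.ne'
  have h := key (m / E)
  have hval : 2 * (m / E * m) - m / E * (m / E * E) = m ^ 2 / E := by
    field_simp
    ring
  rw [hval] at h
  calc ENNReal.ofReal m ^ 2 = ENNReal.ofReal (E * (m ^ 2 / E)) := by
        rw [← ENNReal.ofReal_pow hm0]
        congr 1
        field_simp
    _ = ENNReal.ofReal E * ENNReal.ofReal (m ^ 2 / E) := ENNReal.ofReal_mul hE.le
    _ ≤ ENNReal.ofReal E * hMinusOneSqW L w G := by gcongr

end Summit.AtomisticToContinuum.BoseEinsteinCondensation.Cruxes.InfraredMinimumUncertainty.Sketch2
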